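import Summits.CriticalPhenomena.PercolationContinuityZ3.Theorems.Transplant.KNCells2ThetaPosKit
import Summits.CriticalPhenomena.PercolationContinuityZ3.Theorems.Transplant.KNCellsBoxProdZ2Conc
import Summits.CriticalPhenomena.PercolationContinuityZ3.Theorems.Transplant.BoxProdZ2DropTop
import Summits.CriticalPhenomena.PercolationContinuityZ3.Theorems.Transplant.SamePInputsOpen
import Summits.CriticalPhenomena.PercolationContinuityZ3.Theorems.Transplant.BoxProdZ2TubeMono
import HarnessLib

/-!
# The (D) ASSEMBLY SKELETON for the `X □ ℤ²` node: the exact instance obligations of the concentric endgame, composed with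
# `theta_pos_of_kit₂'` (no envelope bound), p3-g2's concentric geometry `cellGeomC`, `inputs_open_Icc`, `tubeSubcritical_mono` and the drop node
# (HOME/ENTRY-SEED-STAR.md §10–§11; lead (g2) 13:50:03Z: "draft `Transplant/BoxProdZ2ConcAssembly.lean`: theorem `thetaDropBoxProdZ2_of_conc_inputs`
# … the exact list of instance obligations as hypotheses … this pins the interface p2/p3 must meet")

builds on p205010 (kernel theorem, internal audit signed; external expert review pending).
Status sentence (coordinator 2026-08-20T04:30Z): "θ(p_c) = 0 on ℤ^d, all d ≥ 2 — kernel-verified (Lean 4/Mathlib, standard axioms); internal adversarial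
audit SIGNED 2026-08-20 04:29Z; external expert review pending."
Lane `prim-bschramm-*`, seat `prim-bschramm-stmt` (gen 4); helper file (`--supports stmt-CriticalPhenomena-4575`).  Nothing here is a new estimate:
the file NAMES the obligations and proves that they suffice.

THE ENDGAME (design (D), V56): at a density `p` with `θ_{(w,0)}(p) > 0`, tubes subcritical and uniqueness, the instance (p3-g2 I2/I3, p2-g2 G4)
(A) runs the standard estimates ONCE at `p` and hands down a FINITE family of finite-volume strict inequalities — lower bounds `c i < P_p(A i)`
(Lemma 9-prod link clauses, uniqueness-zone clauses; `A i` determined by a finite edge set `F i`) and upper bounds `P_p(B j) < d j` — that HOLD AT `p`;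
(B) for every density `q ∈ [p/2, p]` at which that family holds and the tubes are subcritical, builds the concentric anchored-cells scheme
`concScheme X C w Λ q δc = ⟨cellGeomC X C w Λ, q, δc⟩` (planar cells `C`, radius schedule `Λ` with `Λ.WF C`) together with the three probabilistic
inputs of the node theorem AT `q` — (32) at the root `hQ0`, the target lemma at the faces `hface`, the corridor bound `hreach` — and the
constants `δc ≤ 1`, `0 ≤ ε'`, `δ₂ ≤ 1`, `4((1-δ₂)^K + ε') ≤ 2⁻³²`.  This file proves that (A) + (B) ⟹ the drop node:
* `concScheme` (abbrev) and **`ConcKitAt X C w Λ q δc ε' δ₂ : Prop`** — the conjunction `hQ0 ∧ hface ∧ hreach` for `concScheme … q δc` with the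
  face data `faceDataC` (VERBATIM the corresponding hypotheses of `KNCells.KSchA.theta_pos_of_kit₂'`): THE target of (B);
* **`theta_pos_of_concKitAt`** — `Λ.WF C`, the constants, `0 < q` and `ConcKitAt … q …` ⟹ `0 < θ_{(w,0)}(q)` (p3-g2's six records
  `runGeomC … levelGeomC` discharge every geometric hypothesis of `theta_pos_of_kit₂'`);
* **`thetaDropBoxProdZ2_of_conc_inputs`** — hypothesis = for every `X, w, p` under the node's hypotheses, (A) and (B) as above ⟹ `ThetaDropBoxProdZ2`
  (proof: `SameP.inputs_open_Icc` gives `q₀ ∈ [p/2, p)` where the family still holds; `tubeSubcritical_mono` moves tube-subcriticality to `q₀`;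
  (B) at `q₀`; `theta_pos_of_concKitAt`);  **`bsConj4_boxProdZ2_of_conc_inputs`** — hence `BSConj4_boxProdZ2` (lead's `bsConj4_boxProdZ2_of_dropNode`).
What (B) must contain is thereby fixed: p2-g2's G4 (`hface`/`hreach` from chains over U-levels with stage-indexed radii, enlarged targets and the
excess hypothesis) and p3-g2's I2/I3 (kits / excess at stage-indexed windows; the θ-inputs restated at the running parameter) prove
`(family holds at q) → TubeSubcritical X q → ConcKitAt X C w (Λ …) q …` for their explicit family; `hQ0` at `q` likewise.
[cite: KozmaNitzan2024, §4 Theorem 6 (pp. 25–31), §1 p. 2 (approach 1)] [cite: GrimmettPercolation1999, §7.3 p. 162; Thm. 2.1]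
-/

noncomputable section

open MeasureTheory ProbabilityTheory
open scoped ENNReal Classical

namespace Summit.CriticalPhenomena.PercolationContinuityZ3.Theorems

namespace Transplant

namespace BoxProdZ2

open Literature.Probability.Percolation Literature.Probability.LatticeModels SimpleGraph GadgetSystem ProbeHistory HSiteScheme Contour KNCells
open Literature.Barriers.CriticalPhenomena (IsQuasiTransitive IsGraphAmenable countable_of_connected_of_locallyFinite)

variable {W : Type} [DecidableEq W] (X : SimpleGraph W) [X.LocallyFinite]

/-! ## §1 The concentric scheme at a density and its three probabilistic obligations -/

/-- **The concentric anchored-cells scheme at density `q`**: p3-g2's geometry `cellGeomC X C w Λ` (anchor type `ℕ`), parameter `q`,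
threshold `δc`. [cite: KozmaNitzan2024, §4 pp. 25–27] -/
abbrev concScheme (C : PCells) (w : W) (Λ : ConcRadii) (q : unitInterval) (δc : ℝ) : KSchA (W × Site 2) ℕ :=
  ⟨cellGeomC X C w Λ, q, δc⟩

/-- **The three probabilistic obligations of the (D) endgame at density `q`** for the concentric scheme `S = concScheme X C w Λ q δc` with face
data `faceDataC X C w Λ` on `G = X □ ℤ²` — VERBATIM the hypotheses `hQ0`, `hface`, `hreach` of `KNCells.KSchA.theta_pos_of_kit₂'`:
(32) at the root; for every valid history and onward direction, the target lemma at the faces (accuracy `δ₂`, at the history anchors) and the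
corridor bound (accuracy `ε'`).  THE target of the instance's endgame step (B). [cite: KozmaNitzan2024, §4 (30), (32), Lemma 10 at the faces, Lemmas 11–12] -/
def ConcKitAt (C : PCells) (w : W) (Λ : ConcRadii) (q : unitInterval) (δc ε' δ₂ : ℝ) : Prop :=
  let G := X □ zdGraph 2
  let S : KSchA (W × Site 2) ℕ := concScheme X C w Λ q δc
  let FD := faceDataC X C w Λ
  (∀ du : MDir, 1 - S.δc < (prodBernoulli (pinW (KNLevels.lattW G S.p) ↑(S.U₀ G) ↑(S.U₀ G))).real
      (⋃ t ∈ (↑(S.Γ.M S.Γ.a₀ ((0 : Site 2) + stepVec du)) : Set (W × Site 2)),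
        openConnIn (↑(S.Γ.Q S.Γ.a₀ 0 ∪ S.Γ.Ewv S.Γ.a₀ 0 du) : Set (W × Site 2)) S.Γ.root t)) ∧
  (∀ h e, S.Valid₂ G h e → ∀ du ∈ S.onward G h (tgt e), ∀ j < S.Γ.K, ∀ o : Finset (Sym2 (W × Site 2)),
      1 - δ₂ < (prodBernoulli (S.Wt G h e (S.aOf₁ G h e) (S.aOf₂ G h e) du j o)).real
        (⋃ b ∈ FD.Face (S.aOf₂ G h e) (tgt e) du (j + 1), openConn S.Γ.root b) →
        S.cond G h e (S.aOf₁ G h e) (S.aOf₂ G h e) du j o) ∧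
  (∀ h e, S.Valid₂ G h e → ∀ du ∈ S.onward G h (tgt e),
      1 - ε' < (prodBernoulli (S.Wfull G h e (S.aOf₁ G h e) (S.aOf₂ G h e) du)).real
        (S.Reach G FD h e (S.aOf₁ G h e) (S.aOf₂ G h e) du))

/-! ## §2 The obligations at `q` give `θ_{(w,0)}(q) > 0` -/

/-- **`ConcKitAt` at a positive density gives `θ_{(w,0)}(q) > 0`**: p3-g2's six records for `cellGeomC` (from `Λ.WF C` alone) discharge the
geometry of `theta_pos_of_kit₂'`; the constants and the three obligations are the hypotheses. [cite: KozmaNitzan2024, §4 Theorem 6 (pp. 25–31)] -/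
theorem theta_pos_of_concKitAt [Countable W] (C : PCells) (w : W) {Λ : ConcRadii} (hΛ : Λ.WF C) {q : unitInterval} (hq : 0 < (q : ℝ))
    {δc ε ε' δ₂ : ℝ} (hδc : δc ≤ 1) (hε : ε ≤ (1 / 2) ^ 32) (hε' : 0 ≤ ε') (hδ₂ : δ₂ ≤ 1) (hKε : 4 * ((1 - δ₂) ^ C.K + ε') ≤ ε)
    (hkit : ConcKitAt X C w Λ q δc ε' δ₂) :
    0 < theta (X □ zdGraph 2) (w, (0 : Site 2)) q := by
  obtain ⟨hQ0, hface, hreach⟩ := hkit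
  exact KSchA.theta_pos_of_kit₂' (S := concScheme X C w Λ q δc) (runGeomC X C w) (anchGeomC X C w) (sepGeom₂C X C w hΛ)
    (exitGeomC X C w hΛ) (stepsGeomC X C w hΛ) (levelGeomC X C w hΛ) hδc hε hε' hδ₂ hKε hq hQ0 hface hreach

/-- `p_c(X □ ℤ², (w,0)) ≤ q` from the obligations at `q > 0`. [cite: KozmaNitzan2024, §1 p. 2 (approach 1)] -/
theorem criticalProb_le_of_concKitAt [Countable W] (C : PCells) (w : W) {Λ : ConcRadii} (hΛ : Λ.WF C) {q : unitInterval} (hq : 0 < (q : ℝ))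
    {δc ε ε' δ₂ : ℝ} (hδc : δc ≤ 1) (hε : ε ≤ (1 / 2) ^ 32) (hε' : 0 ≤ ε') (hδ₂ : δ₂ ≤ 1) (hKε : 4 * ((1 - δ₂) ^ C.K + ε') ≤ ε)
    (hkit : ConcKitAt X C w Λ q δc ε' δ₂) :
    criticalProb (X □ zdGraph 2) (w, (0 : Site 2)) ≤ q :=
  OrbitQuotient.criticalProb_le_of_theta_pos _ _ q (theta_pos_of_concKitAt X C w hΛ hq hδc hε hε' hδ₂ hKε hkit)

/-! ## §3 The drop node from the concentric inputs -/

/-- **THE (D) ASSEMBLY**: suppose that for every infinite, connected, locally finite, quasi-transitive, amenable `X`, every `w` and every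
density `p` with a.s. uniqueness, subcritical tubes and `θ_{(w,0)}(p) > 0` the instance supplies
(A) a finite family of finite-volume strict inequalities HOLDING AT `p` — lower bounds `c i < P_p(A i)` (`i ∈ s`, `A i` determined by the finite
edge set `F i`) and upper bounds `P_p(B j) < d j` (`j ∈ t`, `B j` determined by `E j`) on `X □ ℤ²` — and
(B) for every density `q ∈ [p/2, p]` at which the family holds and the tubes are subcritical: planar cells `C`, a well-formed radius schedule
`Λ`, constants `δc ≤ 1`, `0 ≤ ε'`, `δ₂ ≤ 1` with `4((1-δ₂)^K + ε') ≤ 2⁻³²`, and the three obligations `ConcKitAt X C w Λ q δc ε' δ₂`;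
then the drop node `ThetaDropBoxProdZ2` holds.  (Proof: `SameP.inputs_open_Icc` ⟹ `q₀ ∈ [p/2, p)` where (A)'s family holds;
`tubeSubcritical_mono` ⟹ tubes subcritical at `q₀`; (B) at `q₀`; `theta_pos_of_concKitAt`.) [cite: KozmaNitzan2024, §1 p. 2 (approach 1), §4] -/
theorem thetaDropBoxProdZ2_of_conc_inputs
    (h : ∀ {W : Type} [DecidableEq W] (X : SimpleGraph W) [X.LocallyFinite], X.Connected → IsQuasiTransitive X → IsGraphAmenable X →
      Infinite W → ∀ (w : W) (p : unitInterval),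
        (∀ᵐ ω ∂(bondPercolation (X □ zdGraph 2) p), numInfiniteClusters ω ≤ 1) → TubeSubcritical X p →
          0 < theta (X □ zdGraph 2) (w, (0 : Site 2)) p →
            ∃ (ι κ : Type) (s : Finset ι) (A : ι → Set (BondConfig (W × Site 2))) (F : ι → Finset (Sym2 (W × Site 2))) (c : ι → ℝ)
              (t : Finset κ) (B : κ → Set (BondConfig (W × Site 2))) (E : κ → Finset (Sym2 (W × Site 2))) (d : κ → ℝ),
              (∀ i ∈ s, DeterminedBy (A i) (↑(F i) : Set (Sym2 (W × Site 2)))) ∧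
              (∀ j ∈ t, DeterminedBy (B j) (↑(E j) : Set (Sym2 (W × Site 2)))) ∧
              (∀ i ∈ s, c i < (bondPercolation (X □ zdGraph 2) p).real (A i)) ∧
              (∀ j ∈ t, (bondPercolation (X □ zdGraph 2) p).real (B j) < d j) ∧
              ∀ q : unitInterval, (p : ℝ) / 2 ≤ q → (q : ℝ) ≤ p →
                (∀ i ∈ s, c i < (bondPercolation (X □ zdGraph 2) q).real (A i)) →
                (∀ j ∈ t, (bondPercolation (X □ zdGraph 2) q).real (B j) < d j) →
                TubeSubcritical X q →
                  ∃ (C : PCells) (Λ : ConcRadii) (δc ε' δ₂ : ℝ), Λ.WF C ∧ δc ≤ 1 ∧ 0 ≤ ε' ∧ δ₂ ≤ 1 ∧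
                    4 * ((1 - δ₂) ^ C.K + ε') ≤ (1 / 2) ^ 32 ∧ ConcKitAt X C w Λ q δc ε' δ₂) :
    ThetaDropBoxProdZ2 := by
  intro W _ X _ hc hqt ha hinf w p hU hT hθ
  haveI : Countable W := countable_of_connected_of_locallyFinite X hc w
  -- `p > 0` since `θ(0) = 0`
  have hp : 0 < (p : ℝ) := by
    rcases p.2.1.eq_or_lt with h0 | h0
    · exfalso
      have e : p = 0 := Subtype.ext h0.symm
      rw [e, theta_bot] at hθ
      exact lt_irrefl _ hθ
    · exact h0
  obtain ⟨ι, κ, s, A, F, c, t, B, E, d, hA, hB, hc', hd', hstep⟩ := h X hc hqt ha hinf w p hU hT hθ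
  -- (A) persists on `[q₀, p]`, `q₀ ≥ p/2`
  obtain ⟨q₀, hq₀h, hq₀p, hopen⟩ := SameP.inputs_open_Icc (X □ zdGraph 2) s A F hA c t B E hB d p hp hc' hd'
  have hq₀0 : 0 < (q₀ : ℝ) := by linarith
  obtain ⟨hcq, hdq⟩ := hopen q₀ le_rfl hq₀p.le
  -- tubes subcritical at `q₀ ≤ p`
  have hTq : TubeSubcritical X q₀ := tubeSubcritical_mono X (Subtype.coe_le_coe.1 hq₀p.le) hT
  -- (B) at `q₀`
  obtain ⟨C, Λ, δc, ε', δ₂, hΛ, hδc, hε', hδ₂, hKε, hkit⟩ := hstep q₀ hq₀h hq₀p.le hcq hdq hTq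
  exact ⟨q₀, hq₀p, theta_pos_of_concKitAt X C w hΛ hq₀0 hδc le_rfl hε' hδ₂ hKε hkit⟩

/-- **Hence Benjamini–Schramm's Conjecture 4 for every `X □ ℤ²`** from the concentric inputs (A) + (B) (lead's `bsConj4_boxProdZ2_of_dropNode`:
tubes at `p_c` by Martineau–Severo, exponential growth by Hutchcroft, uniqueness by Burton–Keane) — builds on p205010 (kernel theorem, internal audit
signed; external expert review pending). [cite: BenjaminiSchramm1996, Conj. 4] [cite: KozmaNitzan2024, §1 p. 2 (approach 1)] -/
theorem bsConj4_boxProdZ2_of_conc_inputs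
    (h : ∀ {W : Type} [DecidableEq W] (X : SimpleGraph W) [X.LocallyFinite], X.Connected → IsQuasiTransitive X → IsGraphAmenable X →
      Infinite W → ∀ (w : W) (p : unitInterval),
        (∀ᵐ ω ∂(bondPercolation (X □ zdGraph 2) p), numInfiniteClusters ω ≤ 1) → TubeSubcritical X p →
          0 < theta (X □ zdGraph 2) (w, (0 : Site 2)) p →
            ∃ (ι κ : Type) (s : Finset ι) (A : ι → Set (BondConfig (W × Site 2))) (F : ι → Finset (Sym2 (W × Site 2))) (c : ι → ℝ)
              (t : Finset κ) (B : κ → Set (BondConfig (W × Site 2))) (E : κ → Finset (Sym2 (W × Site 2))) (d : κ → ℝ),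
              (∀ i ∈ s, DeterminedBy (A i) (↑(F i) : Set (Sym2 (W × Site 2)))) ∧
              (∀ j ∈ t, DeterminedBy (B j) (↑(E j) : Set (Sym2 (W × Site 2)))) ∧
              (∀ i ∈ s, c i < (bondPercolation (X □ zdGraph 2) p).real (A i)) ∧
              (∀ j ∈ t, (bondPercolation (X □ zdGraph 2) p).real (B j) < d j) ∧
              ∀ q : unitInterval, (p : ℝ) / 2 ≤ q → (q : ℝ) ≤ p →
                (∀ i ∈ s, c i < (bondPercolation (X □ zdGraph 2) q).real (A i)) →
                (∀ j ∈ t, (bondPercolation (X □ zdGraph 2) q).real (B j) < d j) →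
                TubeSubcritical X q →
                  ∃ (C : PCells) (Λ : ConcRadii) (δc ε' δ₂ : ℝ), Λ.WF C ∧ δc ≤ 1 ∧ 0 ≤ ε' ∧ δ₂ ≤ 1 ∧
                    4 * ((1 - δ₂) ^ C.K + ε') ≤ (1 / 2) ^ 32 ∧ ConcKitAt X C w Λ q δc ε' δ₂) :
    BSConj4_boxProdZ2 :=
  bsConj4_boxProdZ2_of_dropNode (thetaDropBoxProdZ2_of_conc_inputs h)

end BoxProdZ2

end Transplant

end Summit.CriticalPhenomena.PercolationContinuityZ3.Theorems

end
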